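import Summits.QuantumFields.YangMills.Theorems.BalabanUVNodesN15TwoSpacingGluingCurvedCoverDefect
import Summits.QuantumFields.YangMills.Theorems.BalabanUVNodesN15TwoSpacingGluingCutRowsDefectCover
import HarnessLib

/-!
# THE GLUING STEP AT TWO LATTICE SPACINGS — (Γ15b) THE LIVE-`U` KNIT AT THE COVER, TWO GRIDS, II: the TAIL DEFECT (53's `hDT`) at the cover, the fine partition's block
# representative ∕ one-step ∕ support rows read through King's pairing (`hrh′`, `hstep′`, `hSχ′`, `hSψ′`), and the two-grid fits of the partition's quotients on the coloured carrier
# (`hf1`, `hf1b`, `hf2`) (dag-n15-c g15, FILE 122; N15 = NE2, s1 «background-layer OPERATOR ingredient»)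

Cell `pub-ymgap`, seat `pub-ymgap-dag-n15-c` (R134 (a); HUMAN RULING D-0062), generation 15.  `bears_on: R4∕N15 · K3⁸ SpineGivenEndpointR13SepCoPHV (stmt-QuantumFields-27366)`.
Filed `--kind proof --supports stmt-QuantumFields-27366 --as helper` — COUNT-NEUTRAL.  Theorems only; 0 `def`, 0 `sorry`.  Imports BY NAME FILE 121 `…CurvedCoverDefect` (through it 117–119,
dag-n15-a `hasMaj_idef_tail_tensorId_neumannCubeG_of`, dag-n15-w4 VI `abs_bcube_cover_fine_sub_le`, FILES 66∕67∕72) and FILE 74 `…CutRowsDefectCover` (`coverFit_params`; through it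
FILES 64∕65 `abs_fgrad_hcube_two_grid_le` ∕ `abs_bgrad_hcube_two_grid_le` ∕ `abs_fgradAdj_fgrad_hcube_two_grid_le`, FILE 67 `coverXi_offset`).  Nothing in the tree is modified.

* §1 ★★★ `hasMaj_idef_tail_cover_lift` — 53's `hDT` at the cover: dag-n15-a's tail defect on the coloured carrier at the WINDOW `H = c′(k) + [w−1, 3w−1)^{d+1}` of the partition's blocks
  (both spacings, FILE 66 `val_blockOf_sub_of_hcube_ne_zero`), the inner box `A = c′(k) + [0, 4w−1)^{d+1}` (117 `bcube_cover_eq_one_of_mem_innerBox`, both spacings), gap `w` (FILE 72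
  `margin_le_tdistT_side`), bump fit `π(d+1)∕(L^k w)` (dag-n15-w4 VI), partition fit (FILE 67); torus letters displayed; target blocks `liftBlk (blk ∘ π) ι`.
* §2 `abs_coverH_sub_coverHb_kingPrV_le` (`hrh′`), `dist_blockOf_kingPrV_step_le` (`hstep′`), `blockOf_kingPrV_mem_cubeBlocks_of_inner_ne_zero` (`hSχ′`), `blockOf_kingPrV_mem_cubeBlocks_of_chiCube_ne_zero` (`hSψ′`).
* §3 ★★ `abs_fgrad_coverH_lift_two_grid_le` ∕ `abs_bgrad_coverH_lift_two_grid_le` ∕ `abs_fgradAdj_fgrad_coverH_lift_two_grid_le` — 53's `hf1`∕`hf1b`∕`hf2` at the cover (weights `c = L^k`,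
  `c′ = L^rL^k` as hypotheses), constants `w⁻¹(L^k w)⁻¹(64π² + π²(d+1))`, `w⁻²(L^k w)⁻¹(144π³ + 32π³(d+1))`.

HONEST FRAMING ∕ LIMITS.  Bookkeeping over LANDED rows on MODEL carriers; no new analytic estimate; nothing of [B5]∕[B6]∕[B9] asserted (Thm 3.14 pp.426–427 = difference TEMPLATE;
(2.36)–(2.37) p.229, (2.92)–(2.93) p.239 shapes).  NE2⁺ NOT PRINTED, NOT proved; N15 NOT discharged; K3⁸ OPEN, skeleton v6 untouched; counts of record UNMOVED (typed 28∕28 ·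
discharged 5∕27); one finite 𝕋⁴ at fixed ε — NOT infinite volume, NOT OS on ℝ⁴, NOT a mass gap, NOT Clay; R4 closes the conditional finite-𝕋⁴ rung `BalabanLadder.UV` only.
-/

noncomputable section

namespace Summit.QuantumFields.YangMills.BalabanUVNodes.N15.Gluing

open Real
open Literature.MathematicalPhysics.QuantumFieldTheory.Balaban1983to89
open Literature.MathematicalPhysics.QuantumFieldTheory.Balaban1983to89.B5Prop11Plancherel (Tor fine unitVec)
open Literature.MathematicalPhysics.QuantumFieldTheory.Balaban1983to89.B11SectG (BlockNorm HasMaj RowSum)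
open Literature.MathematicalPhysics.QuantumFieldTheory.Balaban1983to89.T4EtaRateDefect (idef)
open Literature.MathematicalPhysics.QuantumFieldTheory.Balaban1983to89.T4EtaRateCoeffDefect (pull pull_apply)
open Literature.MathematicalPhysics.QuantumFieldTheory.Balaban1983to89.B6RandomWalk (Triangle254)
open Literature.MathematicalPhysics.QuantumFieldTheory.Balaban1983to89.B6Prop26Gluing (mulOp mulOp_apply ind ind_nonneg ind_le_one)
open Literature.MathematicalPhysics.QuantumFieldTheory.Balaban1983to89.B6UnitTorusCarrier (unitTorusGeo unitTorusGeo_dist_nonneg unitTorusGeo_dist_symm)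
open Literature.MathematicalPhysics.QuantumFieldTheory.King1986.Torus (blockOf tdistT tdistT_nonneg tdistT_symm)
open Summit.QuantumFields.YangMills.BalabanUVNodes.N15.BackgroundLayer (fgrad fgradAdj bgrad fgrad_apply fgradAdj_apply bgrad_apply)
open Summit.QuantumFields.YangMills.BalabanUVNodes.N15.VectorPiece (bshiftEquiv bshiftEquiv_apply kingPrV tensorId hasMaj_tensorId blkFine_comp_kingPrV tdistT_blockOf_sub_unitVec_le kingPrV_eq)
open Summit.QuantumFields.YangMills.BalabanUVNodes.N15.MatrixSpecies (liftBlk liftMap liftEquiv liftEquiv_apply liftEquiv_symm_apply)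
open Summit.QuantumFields.YangMills.BalabanUVNodes.N15.TwoGrid (symbOp sD landauRe qvRe qvAdjRe gOp neumannCubeG chiCube cubeBlocks mem_cubeBlocks tensorId_mulOp mulOp_fst_comp_tensorId
  tail_tensorId_eq hasMaj_idef_tail_tensorId_neumannCubeG_of chiCube_of_not_mem)

variable {d : ℕ}

section Cover

variable {M : Fin (d + 1) → ℕ} [∀ μ, NeZero (M μ)] {L kk r w q m₀ m₁ S₁ : ℕ} [NeZero L] (ι : Type) [Fintype ι]

/-! ## §1 The tail defect at the cover (53's `hDT`) -/

/-- ★★★ **53's `hDT` AT THE COVER**: the two-grid defect of the tails of the dressed smooth-cut cube `□_k` on the coloured carrier — dag-n15-a `hasMaj_idef_tail_tensorId_neumannCubeG_of` at the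
WINDOW of the partition's blocks, the inner box and the gap `w` (`q ≥ 2`, cube side `S` with `m₀ + 2w + 1 ≤ S ≤ 2qw`, `M_ν = 2S`), with the bump fit and partition fit of the cover; the torus
letters `G ≤ Ce^{−δ₀d}`, `𝔇(G′,G) ≤ C₀e^{−δ₀d}`, `∇G ≤ C_De^{−δ₀d}`, `∂Π∂* ≤ C₁e^{−δ₁d}` (both spacings), `𝔇(N′_L, N_L) ≤ r_Ne^{−δ_Nd}` displayed.
[cite: Balaban1985BackgroundPropagators, Thm 3.14 pp.426–427 (difference template); Balaban1984PropagatorsII, (2.92)–(2.93) p.239, (2.133)–(2.134) p.247, (2.156) p.250] -/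
theorem hasMaj_idef_tail_cover_lift {S : ℕ} (hM : ∀ ν, M ν = 2 * q * w) (hM2 : ∀ ν, M ν = 2 * S) (hw : 0 < w) (hq : 2 ≤ q) (hm₀ : w - 1 ≤ m₀) (hfit : m₀ + 2 * w + 1 ≤ S) (hS : S ≤ 2 * q * w)
    {a : ℝ} (ha : 0 < a) {C C₀ CD δ₀ C₁ δ₁ δN rN ρ₁ ρ σ cr : ℝ}
    (htri : Triangle254 (unitTorusGeo L kk M)) (hrow : RowSum (unitTorusGeo L kk M) σ cr) (hC : 0 ≤ C) (hC₀ : 0 ≤ C₀) (hCD : 0 ≤ CD) (hδ₀ : 0 ≤ δ₀) (hC₁ : 0 ≤ C₁) (hδN : 0 ≤ δN)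
    (hδN₁ : δN ≤ δ₁) (hrN : 0 ≤ rN) (hρ₁ : ρ₁ ≤ δN) (hρ : 0 ≤ ρ) (hρδ : ρ ≤ δ₀) (hρσ : ρ + σ ≤ ρ₁)
    (hG : HasMaj (BlockNorm.ofBlocks (unitTorusGeo L kk M) (fun b : Tor (fine (L ^ kk) M) × Fin (d + 1) => blockOf (L ^ kk) M b.1))
      (BlockNorm.ofBlocks (unitTorusGeo L kk M) (fun b : Tor (fine (L ^ kk) M) × Fin (d + 1) => blockOf (L ^ kk) M b.1)) (gOp M (L ^ kk) a) (fun y y' => C * Real.exp (-(δ₀ * tdistT M y y'))))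
    (h0 : HasMaj (BlockNorm.ofBlocks (unitTorusGeo L kk M) (fun b : Tor (fine (L ^ kk) M) × Fin (d + 1) => blockOf (L ^ kk) M b.1))
      (BlockNorm.ofBlocks (unitTorusGeo L kk M) (fun b' : Tor (fine (L ^ r * L ^ kk) M) × Fin (d + 1) => blockOf (L ^ r * L ^ kk) M b'.1))
      (idef (pull (kingPrV L kk r M)) (pull (kingPrV L kk r M)) (gOp M (L ^ r * L ^ kk) a) (gOp M (L ^ kk) a)) (fun y y' => C₀ * Real.exp (-(δ₀ * tdistT M y y'))))
    (h1 : ∀ ν, HasMaj (BlockNorm.ofBlocks (unitTorusGeo L kk M) (fun b : Tor (fine (L ^ kk) M) × Fin (d + 1) => blockOf (L ^ kk) M b.1))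
      (BlockNorm.ofBlocks (unitTorusGeo L kk M) (fun b : Tor (fine (L ^ kk) M) × Fin (d + 1) => blockOf (L ^ kk) M b.1))
      (symbOp M (L ^ kk) (sD M (L ^ kk) ν ((L ^ kk : ℕ) : ℝ)) ∘ₗ gOp M (L ^ kk) a) (fun y y' => CD * Real.exp (-(δ₀ * tdistT M y y'))))
    (hNL : HasMaj (BlockNorm.ofBlocks (unitTorusGeo L kk M) (fun b : Tor (fine (L ^ kk) M) × Fin (d + 1) => blockOf (L ^ kk) M b.1))
      (BlockNorm.ofBlocks (unitTorusGeo L kk M) (fun b : Tor (fine (L ^ kk) M) × Fin (d + 1) => blockOf (L ^ kk) M b.1)) (landauRe M (L ^ kk)) (fun y y' => C₁ * Real.exp (-(δ₁ * tdistT M y y'))))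
    (hNL' : HasMaj (BlockNorm.ofBlocks (unitTorusGeo L kk M) (fun b : Tor (fine (L ^ r * L ^ kk) M) × Fin (d + 1) => blockOf (L ^ r * L ^ kk) M b.1))
      (BlockNorm.ofBlocks (unitTorusGeo L kk M) (fun b : Tor (fine (L ^ r * L ^ kk) M) × Fin (d + 1) => blockOf (L ^ r * L ^ kk) M b.1)) (landauRe M (L ^ r * L ^ kk))
      (fun y y' => C₁ * Real.exp (-(δ₁ * tdistT M y y'))))
    (hDN : HasMaj (BlockNorm.ofBlocks (unitTorusGeo L kk M) (fun b : Tor (fine (L ^ kk) M) × Fin (d + 1) => blockOf (L ^ kk) M b.1))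
      (BlockNorm.ofBlocks (unitTorusGeo L kk M) (fun b : Tor (fine (L ^ r * L ^ kk) M) × Fin (d + 1) => blockOf (L ^ r * L ^ kk) M b.1))
      (idef (pull (kingPrV L kk r M)) (pull (kingPrV L kk r M)) (a • (qvAdjRe M (L ^ r * L ^ kk) ∘ₗ qvRe M (L ^ r * L ^ kk)) + (-landauRe M (L ^ r * L ^ kk)))
        (a • (qvAdjRe M (L ^ kk) ∘ₗ qvRe M (L ^ kk)) + (-landauRe M (L ^ kk)))) (fun y y' => rN * Real.exp (-(δN * tdistT M y y'))))
    (k : Fin (d + 1) → ZMod (2 * q)) :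
    HasMaj (BlockNorm.ofBlocks (unitTorusGeo L kk M) (liftBlk (fun b : Tor (fine (L ^ kk) M) × Fin (d + 1) => blockOf (L ^ kk) M b.1) ι))
      (BlockNorm.ofBlocks (unitTorusGeo L kk M) (liftBlk ((fun b : Tor (fine (L ^ kk) M) × Fin (d + 1) => blockOf (L ^ kk) M b.1) ∘ kingPrV L kk r M) ι))
      (idef (pull (liftMap (kingPrV L kk r M) ι)) (pull (liftMap (kingPrV L kk r M) ι))
        ((-(mulOp (fun p : (Tor (fine (L ^ r * L ^ kk) M) × Fin (d + 1)) × ι => hcube (2 * q) (coverXi M (L ^ r * L ^ kk) w) k p.1) ∘ₗ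
            tensorId ι (a • (qvAdjRe M (L ^ r * L ^ kk) ∘ₗ qvRe M (L ^ r * L ^ kk)) + (-landauRe M (L ^ r * L ^ kk))) ∘ₗ
            mulOp (1 - fun p : (Tor (fine (L ^ r * L ^ kk) M) × Fin (d + 1)) × ι => bcube (2 * q) (coverXi M (L ^ r * L ^ kk) w) 2 k p.1))) ∘ₗ
          tensorId ι (neumannCubeG M (L ^ r * L ^ kk) (coverCorner M w q m₀ k) S a))
        ((-(mulOp (fun p : (Tor (fine (L ^ kk) M) × Fin (d + 1)) × ι => hcube (2 * q) (coverXi M (L ^ kk) w) k p.1) ∘ₗ tensorId ι (a • (qvAdjRe M (L ^ kk) ∘ₗ qvRe M (L ^ kk)) + (-landauRe M (L ^ kk))) ∘ₗ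
            mulOp (1 - fun p : (Tor (fine (L ^ kk) M) × Fin (d + 1)) × ι => bcube (2 * q) (coverXi M (L ^ kk) w) 2 k p.1))) ∘ₗ tensorId ι (neumannCubeG M (L ^ kk) (coverCorner M w q m₀ k) S a)))
      (fun y y' => ind ((cubeBlocks M (coverCorner M w q m₀ k) S : Finset (Tor M)) : Set (Tor M)) y * ind ((cubeBlocks M (coverCorner M w q m₀ k) S : Finset (Tor M)) : Set (Tor M)) y' *
        ((2 ^ (d + 1) * Real.exp δ₀ * cr *
          ((|a| * (Real.exp δN * Real.exp δN) + C₁) * Real.exp (-((δN - ρ₁) * w)) * C₀ +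
            (|a| * (Real.exp δN * Real.exp δN) + C₁) * Real.exp (-((δN - ρ₁) * w)) * ((d + 1) * (CD / (L ^ kk : ℕ))) +
            ((|a| * (Real.exp δN * Real.exp δN) + C₁) * (π * (d + 1) / (((L ^ kk : ℕ) : ℝ) * w)) + rN + (π * (d + 1) / (((L ^ kk : ℕ) : ℝ) * w)) * (|a| * (Real.exp δN * Real.exp δN) + C₁)) *
              Real.exp (-((δN - ρ₁) * w)) * C)) * Real.exp (-(ρ * (unitTorusGeo L kk M).dist y y')))) := by
  have h4 : 4 * w ≤ 2 * q * w := by nlinarith [hq]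
  -- the window set of the partition's blocks and the inner box, shared by both spacings
  have key := hasMaj_idef_tail_tensorId_neumannCubeG_of (ι := ι) (L := L) (k := kk) (r := r) (c := coverCorner M w q m₀ k) (S := S) hM2 ha htri hrow hC hC₀ hCD hδ₀ hC₁ hδN hδN₁ hrN hρ₁ hρ hρδ hρσ
    (by positivity : (0 : ℝ) ≤ π * (d + 1) / (((L ^ kk : ℕ) : ℝ) * w)) (by positivity : (0 : ℝ) ≤ π * (d + 1) / (((L ^ kk : ℕ) : ℝ) * w)) hG h0 h1 hNL hNL' hDN
    (h := hcube (2 * q) (coverXi M (L ^ kk) w) k) (ψ := 1 - bcube (2 * q) (coverXi M (L ^ kk) w) 2 k)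
    (h' := hcube (2 * q) (coverXi M (L ^ r * L ^ kk) w) k) (ψ' := 1 - bcube (2 * q) (coverXi M (L ^ r * L ^ kk) w) 2 k)
    (H := {y : Tor M | ∀ ν, w - 1 ≤ ((y - coverCorner M w q (w - 1) k) ν).val ∧ ((y - coverCorner M w q (w - 1) k) ν).val + 1 ≤ w - 1 + 2 * w})
    (A := ((cubeBlocks M (coverCorner M w q (w - 1) k) (4 * w - 1) : Finset (Tor M)) : Set (Tor M)))
    (fun x hx => by by_contra h; exact hx (fun ν => val_blockOf_sub_of_hcube_ne_zero (m₀ := w - 1) hM hw (by omega) h ν))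
    (fun y hy => mem_cubeBlocks_of_mem_inner (m₁ := w - 1) (S₁ := 3 * w - 1) hM hm₀ (by omega) hS
      ((mem_cubeBlocks _).mpr fun ν => by have := (hy ν).2; show ((y - coverCorner M w q (w - 1) k) ν).val < 3 * w - 1; omega))
    (fun x => abs_one_sub_bcube_cover_le_one 2 k x)
    (fun x hx => by rw [Pi.sub_apply, Pi.one_apply, bcube_cover_eq_one_of_mem_innerBox hM hw (Finset.mem_coe.mp hx), sub_self])
    (fun x' => abs_coverH_le_one k x')
    (fun x' hx' => by by_contra h; exact hx' (fun ν => val_blockOf_sub_of_hcube_ne_zero (m₀ := w - 1) hM hw (by omega) h ν))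
    (fun x' => abs_one_sub_bcube_cover_le_one 2 k x')
    (fun x' hx' => by rw [Pi.sub_apply, Pi.one_apply, bcube_cover_eq_one_of_mem_innerBox hM hw (Finset.mem_coe.mp hx'), sub_self])
    (fun x' => abs_coverH_fine_sub_le kk r hM hw k x')
    (fun x' => by
      rw [Pi.sub_apply, Pi.one_apply, Pi.sub_apply, Pi.one_apply, show (1 : ℝ) - bcube (2 * q) (coverXi M (L ^ r * L ^ kk) w) 2 k x' - (1 - bcube (2 * q) (coverXi M (L ^ kk) w) 2 k (kingPrV L kk r M x'))
        = -(bcube (2 * q) (coverXi M (L ^ r * L ^ kk) w) 2 k x' - bcube (2 * q) (coverXi M (L ^ kk) w) 2 k (kingPrV L kk r M x')) by ring, abs_neg]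
      exact abs_bcube_cover_fine_sub_le 2 hM hw k x')
    (fun y y' hy hy' => by
      have h := margin_le_tdistT_side (m₀ := w - 1) (S := 4 * w - 1) hM (by omega) (by omega) (fun h => hy' (Finset.mem_coe.mpr h)) hy
      rw [tdistT_symm, Nat.cast_sub (by omega), Nat.cast_one, sub_add_cancel] at h
      exact h)
  rw [mulOp_one_sub_fst, mulOp_one_sub_fst, liftBlk_blkCover_comp_kingPrV]
  exact key


/-! ## §2 The fine partition's rows read through King's pairing (53's `hrh′`, `hstep′`, `hSχ′`, `hSψ′`) -/

omit [Fintype ι] in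
/-- `hrh′`: the fine partition against the coarse block representative read through the pairing. [folklore] -/
theorem abs_coverH_sub_coverHb_kingPrV_le (hM : ∀ ν, M ν = 2 * q * w) (hw : 0 < w) (k : Fin (d + 1) → ZMod (2 * q)) (p' : (Tor (fine (L ^ r * L ^ kk) M) × Fin (d + 1)) × ι) :
    |hcube (2 * q) (coverXi M (L ^ r * L ^ kk) w) k p'.1 - coverHb M (L ^ kk) w q k (liftBlk ((fun b : Tor (fine (L ^ kk) M) × Fin (d + 1) => blockOf (L ^ kk) M b.1) ∘ kingPrV L kk r M) ι p')| ≤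
      π * (d + 1) / w := by
  have h := abs_coverH_sub_coverHb_le (M := M) (n := L ^ r * L ^ kk) hM hw k p'.1
  rwa [coverHb_eq_of_spacing (L ^ kk) (L ^ r * L ^ kk) hw k, ← congrFun (blkFine_comp_kingPrV (M := M) L kk r) p'.1] at h

omit [Fintype ι] in
/-- `hstep′`: one fine step moves the coarse block (read through the pairing) by at most one. [folklore] -/
theorem dist_blockOf_kingPrV_step_le (μ : Fin (d + 1)) (x' : Tor (fine (L ^ r * L ^ kk) M) × Fin (d + 1)) :
    (unitTorusGeo L kk M).dist (blockOf (L ^ kk) M (kingPrV L kk r M (bshiftEquiv M (L ^ r * L ^ kk) μ x')).1) (blockOf (L ^ kk) M (kingPrV L kk r M x').1) ≤ 1 := by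
  have e1 : ∀ z : Tor (fine (L ^ r * L ^ kk) M) × Fin (d + 1), blockOf (L ^ kk) M (kingPrV L kk r M z).1 = blockOf (L ^ r * L ^ kk) M z.1 :=
    fun z => congrFun (blkFine_comp_kingPrV (M := M) L kk r) z
  have h := tdistT_blockOf_sub_unitVec_le (L ^ r * L ^ kk) M (x'.1 + unitVec (fine (L ^ r * L ^ kk) M) μ) μ
  rw [add_sub_cancel_right, tdistT_symm] at h
  show tdistT M _ _ ≤ 1
  rw [e1, e1]
  exact h

omit [Fintype ι] in
/-- `hSχ′`: the support of the fine cut box lies in the cube's blocks, read through the pairing. [folklore] -/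
theorem blockOf_kingPrV_mem_cubeBlocks_of_inner_ne_zero (hM : ∀ ν, M ν = 2 * q * w) (hm : m₁ ≤ m₀) (hfit : (m₀ - m₁) + S₁ ≤ q * w) (hS₀ : q * w ≤ 2 * q * w)
    {k : Fin (d + 1) → ZMod (2 * q)} {x' : Tor (fine (L ^ r * L ^ kk) M) × Fin (d + 1)} (hx : chiCube M (L ^ r * L ^ kk) (coverCorner M w q m₁ k) S₁ x' ≠ 0) :
    blockOf (L ^ kk) M (kingPrV L kk r M x').1 ∈ ((cubeBlocks M (coverCorner M w q m₀ k) (q * w) : Finset (Tor M)) : Set (Tor M)) := by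
  have e1 : blockOf (L ^ kk) M (kingPrV L kk r M x').1 = blockOf (L ^ r * L ^ kk) M x'.1 := congrFun (blkFine_comp_kingPrV (M := M) L kk r) x'
  rw [e1]
  exact Finset.mem_coe.mpr (blockOf_mem_cubeBlocks_of_inner_ne_zero hM hm hfit hS₀ hx)

omit [Fintype ι] in
/-- `hSψ′`: the support of the fine cube indicator lies in the cube's blocks, read through the pairing. [folklore] -/
theorem blockOf_kingPrV_mem_cubeBlocks_of_chiCube_ne_zero {k : Fin (d + 1) → ZMod (2 * q)} {x' : Tor (fine (L ^ r * L ^ kk) M) × Fin (d + 1)}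
    (hx : chiCube M (L ^ r * L ^ kk) (coverCorner M w q m₀ k) (q * w) x' ≠ 0) :
    blockOf (L ^ kk) M (kingPrV L kk r M x').1 ∈ ((cubeBlocks M (coverCorner M w q m₀ k) (q * w) : Finset (Tor M)) : Set (Tor M)) := by
  have e1 : blockOf (L ^ kk) M (kingPrV L kk r M x').1 = blockOf (L ^ r * L ^ kk) M x'.1 := congrFun (blkFine_comp_kingPrV (M := M) L kk r) x'
  rw [e1]
  exact Finset.mem_coe.mpr (by by_contra h; exact hx (chiCube_of_not_mem h))

/-! ## §3 The two-grid fits of the partition's quotients on the coloured carrier (53's `hf1`, `hf1b`, `hf2`) -/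

omit [Fintype ι] in
/-- ★★ **53's `hf1` AT THE COVER**: `|∇̂′_μ(h′_k∘fst)(p′) − ∇̂_μ(h_k∘fst)(π̂p′)| ≤ |w⁻¹|(L^k w)⁻¹(64π² + π²(d+1))` (FILE 64 at the cover, weights `L^k`, `L^rL^k`; `3 ≤ L^k w`).
[cite: Balaban1985BackgroundPropagators, Thm 3.14 pp.426–427 (difference template); Balaban1984PropagatorsII, (2.36) p.229] -/
theorem abs_fgrad_coverH_lift_two_grid_le (hM : ∀ ν, M ν = 2 * q * w) (hw : 0 < w) (h3 : 3 ≤ L ^ kk * w) (k : Fin (d + 1) → ZMod (2 * q)) (μ : Fin (d + 1))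
    (p' : (Tor (fine (L ^ r * L ^ kk) M) × Fin (d + 1)) × ι) :
    |fgrad ((L ^ r * L ^ kk : ℕ) : ℝ) (liftEquiv (bshiftEquiv M (L ^ r * L ^ kk) μ) ι) (fun p : (Tor (fine (L ^ r * L ^ kk) M) × Fin (d + 1)) × ι => hcube (2 * q) (coverXi M (L ^ r * L ^ kk) w) k p.1) p' -
        fgrad ((L ^ kk : ℕ) : ℝ) (liftEquiv (bshiftEquiv M (L ^ kk) μ) ι) (fun p : (Tor (fine (L ^ kk) M) × Fin (d + 1)) × ι => hcube (2 * q) (coverXi M (L ^ kk) w) k p.1) (liftMap (kingPrV L kk r M) ι p')| ≤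
      |((w : ℝ))⁻¹| * (((L ^ kk : ℕ) : ℝ) * w)⁻¹ * (64 * π ^ 2 + π ^ 2 * Fintype.card (Fin (d + 1))) := by
  have hL1 : 1 ≤ L := Nat.pos_of_ne_zero (NeZero.ne L)
  obtain ⟨hs0, -, hs1', -, hsL, hnκ, hnκ'⟩ := coverFit_params (L := L) (kk := kk) (r := r) (w := w) hL1 hw h3
  have hq : 0 < q := by
    rcases Nat.eq_zero_or_pos q with h | h
    · exfalso; have := NeZero.ne (M 0); rw [hM 0, h] at this; simp at this
    · exact h
  have hK2 : 2 ≤ 2 * q := by omega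
  have hLr : 1 ≤ L ^ r := Nat.one_le_pow _ _ hL1
  rw [abs_fgrad_lift_pair_eq]
  exact abs_fgrad_hcube_two_grid_le (2 * q) (coverXi M (L ^ kk) w) (coverXi M (L ^ r * L ^ kk) w) (kingPrV L kk r M) (bshiftEquiv M (L ^ kk)) (bshiftEquiv M (L ^ r * L ^ kk))
    hK2 hLr hs0 hs1' hsL hnκ hnκ' (fun μ ν b => coverXi_shift hM hw μ ν b) (fun μ ν b => coverXi_shift hM hw μ ν b) (fun ν x' => coverXi_offset (M := M) (L := L) (kk := kk) (r := r) (w := w) (q := q) ν x') k μ p'.1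

omit [Fintype ι] in
/-- ★★ **53's `hf1b` AT THE COVER**: the backward-quotient fit, same constant. [cite: Balaban1985BackgroundPropagators, Thm 3.14 pp.426–427 (template)] -/
theorem abs_bgrad_coverH_lift_two_grid_le (hM : ∀ ν, M ν = 2 * q * w) (hw : 0 < w) (h3 : 3 ≤ L ^ kk * w) (k : Fin (d + 1) → ZMod (2 * q)) (μ : Fin (d + 1))
    (p' : (Tor (fine (L ^ r * L ^ kk) M) × Fin (d + 1)) × ι) :
    |bgrad ((L ^ r * L ^ kk : ℕ) : ℝ) (liftEquiv (bshiftEquiv M (L ^ r * L ^ kk) μ) ι) (fun p : (Tor (fine (L ^ r * L ^ kk) M) × Fin (d + 1)) × ι => hcube (2 * q) (coverXi M (L ^ r * L ^ kk) w) k p.1) p' -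
        bgrad ((L ^ kk : ℕ) : ℝ) (liftEquiv (bshiftEquiv M (L ^ kk) μ) ι) (fun p : (Tor (fine (L ^ kk) M) × Fin (d + 1)) × ι => hcube (2 * q) (coverXi M (L ^ kk) w) k p.1) (liftMap (kingPrV L kk r M) ι p')| ≤
      |((w : ℝ))⁻¹| * (((L ^ kk : ℕ) : ℝ) * w)⁻¹ * (64 * π ^ 2 + π ^ 2 * Fintype.card (Fin (d + 1))) := by
  have hL1 : 1 ≤ L := Nat.pos_of_ne_zero (NeZero.ne L)
  obtain ⟨hs0, -, hs1', -, hsL, hnκ, hnκ'⟩ := coverFit_params (L := L) (kk := kk) (r := r) (w := w) hL1 hw h3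
  have hq : 0 < q := by
    rcases Nat.eq_zero_or_pos q with h | h
    · exfalso; have := NeZero.ne (M 0); rw [hM 0, h] at this; simp at this
    · exact h
  have hK2 : 2 ≤ 2 * q := by omega
  have hLr : 1 ≤ L ^ r := Nat.one_le_pow _ _ hL1
  rw [abs_bgrad_lift_pair_eq]
  exact abs_bgrad_hcube_two_grid_le (2 * q) (coverXi M (L ^ kk) w) (coverXi M (L ^ r * L ^ kk) w) (kingPrV L kk r M) (bshiftEquiv M (L ^ kk)) (bshiftEquiv M (L ^ r * L ^ kk))
    hK2 hLr hs0 hs1' hsL hnκ hnκ' (fun μ ν b => coverXi_shift hM hw μ ν b) (fun μ ν b => coverXi_shift hM hw μ ν b) (fun ν x' => coverXi_offset (M := M) (L := L) (kk := kk) (r := r) (w := w) (q := q) ν x') k μ p'.1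

omit [Fintype ι] in
/-- ★★ **53's `hf2` AT THE COVER**: the directional-Laplacian fit, constant `w⁻²(L^k w)⁻¹(144π³ + 32π³(d+1))`. [cite: Balaban1985BackgroundPropagators, Thm 3.14 pp.426–427 (template)] -/
theorem abs_fgradAdj_fgrad_coverH_lift_two_grid_le (hM : ∀ ν, M ν = 2 * q * w) (hw : 0 < w) (h3 : 3 ≤ L ^ kk * w) (k : Fin (d + 1) → ZMod (2 * q)) (μ : Fin (d + 1))
    (p' : (Tor (fine (L ^ r * L ^ kk) M) × Fin (d + 1)) × ι) :
    |fgradAdj ((L ^ r * L ^ kk : ℕ) : ℝ) (liftEquiv (bshiftEquiv M (L ^ r * L ^ kk) μ) ι) (fgrad ((L ^ r * L ^ kk : ℕ) : ℝ) (liftEquiv (bshiftEquiv M (L ^ r * L ^ kk) μ) ι)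
          (fun p : (Tor (fine (L ^ r * L ^ kk) M) × Fin (d + 1)) × ι => hcube (2 * q) (coverXi M (L ^ r * L ^ kk) w) k p.1)) p' -
        fgradAdj ((L ^ kk : ℕ) : ℝ) (liftEquiv (bshiftEquiv M (L ^ kk) μ) ι) (fgrad ((L ^ kk : ℕ) : ℝ) (liftEquiv (bshiftEquiv M (L ^ kk) μ) ι)
          (fun p : (Tor (fine (L ^ kk) M) × Fin (d + 1)) × ι => hcube (2 * q) (coverXi M (L ^ kk) w) k p.1)) (liftMap (kingPrV L kk r M) ι p')| ≤
      ((w : ℝ))⁻¹ ^ 2 * (((L ^ kk : ℕ) : ℝ) * w)⁻¹ * (144 * π ^ 3 + 32 * π ^ 3 * Fintype.card (Fin (d + 1))) := by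
  have hL1 : 1 ≤ L := Nat.pos_of_ne_zero (NeZero.ne L)
  obtain ⟨hs0, hs13, -, hs1, hsL, hnκ, hnκ'⟩ := coverFit_params (L := L) (kk := kk) (r := r) (w := w) hL1 hw h3
  have hq : 0 < q := by
    rcases Nat.eq_zero_or_pos q with h | h
    · exfalso; have := NeZero.ne (M 0); rw [hM 0, h] at this; simp at this
    · exact h
  have hK2 : 2 ≤ 2 * q := by omega
  have hLr : 1 ≤ L ^ r := Nat.one_le_pow _ _ hL1
  rw [abs_fgradAdj_fgrad_lift_pair_eq]
  exact abs_fgradAdj_fgrad_hcube_two_grid_le (2 * q) (coverXi M (L ^ kk) w) (coverXi M (L ^ r * L ^ kk) w) (kingPrV L kk r M) (bshiftEquiv M (L ^ kk)) (bshiftEquiv M (L ^ r * L ^ kk))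
    hK2 hLr hs0 hs13 hs1 hsL hnκ hnκ' (fun μ ν b => coverXi_shift hM hw μ ν b) (fun μ ν b => coverXi_shift hM hw μ ν b) (fun ν x' => coverXi_offset (M := M) (L := L) (kk := kk) (r := r) (w := w) (q := q) ν x') k μ p'.1

end Cover

end Summit.QuantumFields.YangMills.BalabanUVNodes.N15.Gluing

end
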